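import Literature.InformationTheory.QuantumCodes.DrawnCheckMatrixCrossingPaths
import Literature.InformationTheory.QuantumCodes.InhomogeneousDensityBound
import HarnessLib

/-!
# Check matrices drawn on `ℤ^d`, continued: the height gap between the rough edges (`n ≥ n₀`), the half-weight step, and the
# Dennis–Kitaev–Landahl–Preskill relative-polygon counting bound `Prob[odd-crossing residual] ≤ |B|·C·r^{n₀}/(1-r)`

Topic `Literature/InformationTheory/QuantumCodes` (venture QEC, LADDER-QEC rung Q5, PARTITION row 09; qec-type-09 gen 7, cell
item «09.RSCPH»). All PROVED, kernel axioms, no named fact. Continues `DrawnCheckMatrixCrossingPaths.lean` (`CheckDrawing M d B Tt`: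
sites, bonds, incidence = geometry, virtual bottom / top sites, `bot`; hand-shaking; crossing paths `IsCrossing`, `pathLocs`,
`card_pathLocs`, `mulVec_pathLocs`, extraction `exists_crossing_subset`):

* `HeightGap n₀`, `le_length_of_isCrossing` — if an additive height `φ : ℤ^d → ℤ` with `|φ(eᵢ)| ≤ 1` is `c` on the bottom
  virtual sites and `c + n₀` on the top ones, every crossing self-avoiding path has `n ≥ n₀` bonds (DKLP: `H ≥ L`);
* ★ `exists_crossing_of_oddResidual` — DKLP eq. (e_ineq): the residual `D(ME) + E` of a MINIMUM-WEIGHT decoder with an odd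
  bottom crossing (`Σ_ℓ residual(ℓ)·bot(ℓ) = 1`) contains a crossing self-avoiding path with at least half of its locations
  in `supp E` (the generic `PlanarCode.card_le_two_mul_card_inter_supp`);
* ★ `sum_indepWeight_oddResidual_le` — under INDEPENDENT errors with location-dependent rates `0 ≤ r_ℓ ≤ ρ ≤ 1/2` and a walk
  count `cₙ(ℤ^d) ≤ C νⁿ` with `r = 2ν√(ρ(1-ρ)) < 1`: `Σ_{E : odd-crossing residual} w(E) ≤ Σ_{n ≥ n₀} |B|·cₙ·(2√(ρ(1-ρ)))ⁿ
  ≤ |B|·C·r^{n₀}/(1-r)` (`|B|` bottom virtual sites to start from; eqs. (27)–(29), (fail); the inhomogeneous Peierls bound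
  `sum_indepWeight_le_of_cover`); `sum_bernoulliWeight_oddResidual_le` — the i.i.d. case `r_ℓ = p`.

## References

* [DennisEtAl2002] E. Dennis, A. Kitaev, A. Landahl, J. Preskill, *Topological quantum memory*, J. Math. Phys. 43 (2002)
  4452–4505, arXiv:quant-ph/0110143, §5.2 (eqs. (e_ineq), (27)–(28); "homologically nontrivial (self-avoiding) path must
  contain at least L links"), §5.3 (eqs. (29), (saw_d), (fail_2d), (fail_iso); relative polygons of planar codes).
* [MadrasSlade1993] N. Madras, G. Slade, *The Self-Avoiding Walk*, Birkhäuser 1993, §1.1 (`cₙ`).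
-/

namespace Literature.InformationTheory.QuantumCodes

open Finset Matrix
open Literature.Probability.LatticeModels (Site zdGraph)
open Literature.Probability.RandomPlanarGeometry
open Literature.Probability.RandomPlanarGeometry.SAW.Zd (saws mem_saws card_saws zdGraph_adj_iff_sub)

namespace CheckDrawing

variable {X Λ B Tt : Type*} {d : ℕ} {M : Matrix X Λ (ZMod 2)} (Δ : CheckDrawing M d B Tt)

/-! ### Height and length -/

/-- **A height gap of `n₀` between the rough edges**: an additive height `φ : ℤ^d → ℤ` changing by at most `1` along every
unit vector, constant `= c` on the bottom virtual sites and `= c + n₀` on the top ones (planar code: `φ = a`; rotated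
surface code: `φ = u - v`). [cite: DennisEtAl2002, §5.2 ("homologically nontrivial (self-avoiding) path must contain at least L links")] -/
def HeightGap (n₀ : ℕ) : Prop :=
  ∃ (φ : Site d →+ ℤ) (c : ℤ), (∀ i : Fin d, |φ (Pi.single i 1)| ≤ 1) ∧ (∀ b, φ (Δ.vb b) = c) ∧
    ∀ t, φ (Δ.vt t) = c + n₀

/-- Along a nearest-neighbour walk from the origin an additive height with `|φ(eᵢ)| ≤ 1` satisfies `|φ(ω(i))| ≤ i`. [folklore] -/
private theorem abs_height_le {φ : Site d →+ ℤ} (hφ : ∀ i : Fin d, |φ (Pi.single i 1)| ≤ 1) {ω : ℕ → Site d} {n : ℕ}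
    (h0 : ω 0 = 0) (hadj : ∀ i < n, (zdGraph d).Adj (ω i) (ω (i + 1))) : ∀ i ≤ n, |φ (ω i)| ≤ (i : ℤ) := by
  intro i
  induction i with
  | zero => intro _; simp [h0]
  | succ i ih =>
    intro hi
    have hprev := ih (by omega)
    have hstep : |φ (ω (i + 1)) - φ (ω i)| ≤ 1 := by
      obtain ⟨k, hk | hk⟩ := (zdGraph_adj_iff_sub _ _).1 (hadj i (by omega))
      · rw [← map_sub, hk]; exact hφ k
      · rw [abs_sub_comm, ← map_sub, hk]; exact hφ k
    calc |φ (ω (i + 1))| = |(φ (ω (i + 1)) - φ (ω i)) + φ (ω i)| := by ring_nf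
      _ ≤ |φ (ω (i + 1)) - φ (ω i)| + |φ (ω i)| := abs_add_le _ _
      _ ≤ ((i + 1 : ℕ) : ℤ) := by push_cast; linarith

/-- **A rough-to-rough path has at least `n₀` bonds** when the rough edges are `n₀` apart in height.
[cite: DennisEtAl2002, §5.2 ("at least L links")] -/
theorem le_length_of_isCrossing {n₀ : ℕ} (hgap : Δ.HeightGap n₀) {b₀ : B} {n : ℕ} {ω : ℕ → Site d}
    (hω : ω ∈ saws d n) (hX : Δ.IsCrossing b₀ n ω) : n₀ ≤ n := by
  obtain ⟨φ, c, hφ, hb, ht⟩ := hgap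
  obtain ⟨h0, -, hadj, -⟩ := mem_saws.1 hω
  obtain ⟨t, hbt⟩ := hX.2
  have hφn : φ (ω n) = n₀ := by
    have := congrArg φ hbt
    rw [map_add, hb, ht] at this
    linarith
  have hb' := abs_height_le hφ h0 hadj n le_rfl
  rw [hφn] at hb'
  have := le_of_abs_le hb'
  omega

/-! ### The half-weight step -/

/-- `x + y = 0 → x = y` in `ℤ₂`. [folklore] -/
private theorem zmod2_eq_of_add_eq_zero {x y : ZMod 2} (h : x + y = 0) : x = y := by
  revert x y; decide

/-- ★ **An odd-crossing residual of a minimum-weight decoder contains a half-faulty rough-to-rough self-avoiding path**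
(DKLP eq. (e_ineq): the syndrome-free path can be added to the correction without changing its syndrome, so the correction
carries at most half of the path, hence the error at least half): for a minimum-weight decoder `D` of `(M, ker M)` and an
error `E` with `Σ_ℓ (D(ME) + E)(ℓ)·bot(ℓ) = 1`, some crossing path has `n ≤ 2·#(its locations in supp E)`.
[cite: DennisEtAl2002, §5.2 (eq. (e_ineq), H_e ≥ H/2)] -/
theorem exists_crossing_of_oddResidual [Fintype X] [Fintype Λ] [DecidableEq Λ]
    {D : Decoder (X → ZMod 2) (Λ → ZMod 2)}
    (hD : D.IsMinWeight (fun e => M *ᵥ e) {x | M *ᵥ x = 0} hammingNorm) {E : Λ → ZMod 2}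
    (hodd : ∑ ℓ, (D (M *ᵥ E) + E) ℓ * Δ.bot ℓ = 1) :
    ∃ (b₀ : B) (n : ℕ) (ω : ℕ → Site d), ω ∈ saws d n ∧ Δ.IsCrossing b₀ n ω ∧
      n ≤ 2 * (Δ.pathLocs b₀ n ω ∩ supp E).card := by
  classical
  set E' := D (M *ᵥ E) with hE'
  have hc : M *ᵥ (E' + E) = 0 := hD.add_mem E
  obtain ⟨b₀, n, ω, hω, hX, hsub⟩ :=
    Δ.exists_crossing_subset (Er := supp (E' + E)) hc (fun ℓ hℓ => by simpa [supp] using hℓ) hodd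
  refine ⟨b₀, n, ω, hω, hX, ?_⟩
  set χ : Λ → ZMod 2 := fun ℓ => if ℓ ∈ Δ.pathLocs b₀ n ω then 1 else 0 with hχ
  have hχ0 : M *ᵥ χ = 0 := Δ.mulVec_pathLocs hω hX (χ := χ) fun ℓ => rfl
  have hsyn : M *ᵥ (E' + χ) = M *ᵥ E := by
    rw [Matrix.mulVec_add, hχ0, add_zero]
    rw [Matrix.mulVec_add] at hc
    funext x
    exact zmod2_eq_of_add_eq_zero (congrFun hc x)
  have hmin : hammingNorm E' ≤ hammingNorm (E' + χ) := by
    have := hD.weight_le (E' + χ)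
    rwa [hsyn] at this
  calc n = (Δ.pathLocs b₀ n ω).card := (Δ.card_pathLocs hω hX).symm
    _ ≤ 2 * (Δ.pathLocs b₀ n ω ∩ supp E).card :=
        PlanarCode.card_le_two_mul_card_inter_supp (fun ℓ => rfl) hsub hmin

/-! ### Counting and the union bound -/

/-- A binary chain is determined by its support. [folklore] -/
private theorem supp_injective {V : Type*} [Fintype V] [DecidableEq V] :
    Function.Injective (supp : (V → ZMod 2) → Finset V) := by
  intro e₁ e₂ h
  funext v
  have h1 : v ∈ supp e₁ ↔ v ∈ supp e₂ := by rw [h]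
  simp only [supp, Finset.mem_filter, Finset.mem_univ, true_and] at h1
  have key : ∀ x y : ZMod 2, (x ≠ 0 ↔ y ≠ 0) → x = y := by decide
  exact key _ _ h1

open Classical in
/-- ★ **DKLP's relative-polygon counting bound, generic and inhomogeneous**: for a drawing with `|B|` bottom virtual sites and
height gap `n₀`, a minimum-weight decoder `D` of `(M, ker M)`, INDEPENDENT errors with location-dependent rates
`0 ≤ r_ℓ ≤ ρ ≤ 1/2`, and a walk count `cₙ(ℤ^d) ≤ C νⁿ` with `r = 2ν√(ρ(1-ρ)) < 1`, the total probability of the errors whose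
residual has an odd bottom crossing is at most `Σ_{n ≥ n₀} |B|·cₙ·(2√(ρ(1-ρ)))ⁿ ≤ |B|·C·r^{n₀}/(1-r)`.
[cite: DennisEtAl2002, §5.2 eqs. (27)–(28) (with p̃ at the largest rate), §5.3 eqs. (29), (saw_d), (fail)] -/
theorem sum_indepWeight_oddResidual_le [Fintype X] [Fintype Λ] [DecidableEq Λ] [Fintype B] {n₀ : ℕ}
    (hgap : Δ.HeightGap n₀) {C ν : ℝ} (hν : 0 < ν) (hC : ∀ n : ℕ, (SAW.Zd.count d n : ℝ) ≤ C * ν ^ n)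
    {D : Decoder (X → ZMod 2) (Λ → ZMod 2)}
    (hD : D.IsMinWeight (fun e => M *ᵥ e) {x | M *ᵥ x = 0} hammingNorm)
    {r : Λ → ℝ} {ρ : ℝ} (hr0 : ∀ ℓ, 0 ≤ r ℓ) (hrρ : ∀ ℓ, r ℓ ≤ ρ) (hρ : ρ ≤ 1 / 2)
    (hr1 : 2 * ν * Real.sqrt (ρ * (1 - ρ)) < 1) :
    ∑ E ∈ univ.filter (fun E : Λ → ZMod 2 => ∑ ℓ, (D (M *ᵥ E) + E) ℓ * Δ.bot ℓ = 1), indepWeight r (supp E) ≤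
      (Fintype.card B : ℝ) * C * (2 * ν * Real.sqrt (ρ * (1 - ρ))) ^ n₀ / (1 - 2 * ν * Real.sqrt (ρ * (1 - ρ))) := by
  classical
  set s := Real.sqrt (ρ * (1 - ρ)) with hs
  set r' := 2 * ν * s with hr
  have hs0 : 0 ≤ s := Real.sqrt_nonneg _
  have hr0' : 0 ≤ r' := by rw [hr]; positivity
  have h1r : 0 < 1 - r' := by linarith
  have hC0 : 0 ≤ C := by
    have h0 := hC 0
    rw [SAW.Zd.count_zero, pow_zero, mul_one, Nat.cast_one] at h0
    linarith
  set F := univ.filter (fun E : Λ → ZMod 2 => ∑ ℓ, (D (M *ᵥ E) + E) ℓ * Δ.bot ℓ = 1) with hF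
  have hsum : ∑ E ∈ F, indepWeight r (supp E) = ∑ S ∈ F.image supp, indepWeight r S :=
    (Finset.sum_image fun e₁ _ e₂ _ h => supp_injective h).symm
  rw [hsum]
  set Mx := Fintype.card Λ with hMx
  set I : Finset (Σ _ : ℕ, B × (ℕ → Site d)) :=
    (Finset.Ico n₀ (Mx + 1)).sigma fun n => (univ : Finset B) ×ˢ saws d n with hI
  set Ps : Finset (Σ _ : ℕ, B × (ℕ → Site d)) := I.filter (fun x => Δ.IsCrossing x.2.1 x.1 x.2.2) with hPs
  set Tm : (Σ _ : ℕ, B × (ℕ → Site d)) → Finset Λ := fun x => Δ.pathLocs x.2.1 x.1 x.2.2 with hTm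
  have hmem : ∀ x ∈ Ps, x.2.2 ∈ saws d x.1 ∧ Δ.IsCrossing x.2.1 x.1 x.2.2 := by
    intro x hx
    rw [hPs, Finset.mem_filter, hI, Finset.mem_sigma, Finset.mem_product] at hx
    exact ⟨hx.1.2.2, hx.2⟩
  have hcard : ∀ x ∈ Ps, (Tm x).card = x.1 := fun x hx => Δ.card_pathLocs (hmem x hx).1 (hmem x hx).2
  have hcover : ∀ S ∈ F.image supp, ∃ x ∈ Ps, (Tm x).card ≤ 2 * (Tm x ∩ S).card := by
    intro S hS
    obtain ⟨E, hE, rfl⟩ := Finset.mem_image.1 hS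
    have hodd := (Finset.mem_filter.1 hE).2
    obtain ⟨b₀, n, ω, hω, hX, hhalf⟩ := Δ.exists_crossing_of_oddResidual hD hodd
    have hn₀ : n₀ ≤ n := Δ.le_length_of_isCrossing hgap hω hX
    have hnM : n ≤ Mx := by
      rw [← Δ.card_pathLocs hω hX]
      exact Finset.card_le_univ _
    refine ⟨⟨n, b₀, ω⟩, ?_, ?_⟩
    · rw [hPs, Finset.mem_filter, hI, Finset.mem_sigma, Finset.mem_product, Finset.mem_Ico]
      exact ⟨⟨⟨hn₀, Nat.lt_succ_of_le hnM⟩, Finset.mem_univ _, hω⟩, hX⟩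
    · show (Δ.pathLocs b₀ n ω).card ≤ 2 * (Δ.pathLocs b₀ n ω ∩ supp E).card
      rw [Δ.card_pathLocs hω hX]
      exact hhalf
  have h1 := sum_indepWeight_le_of_cover hr0 hrρ hρ Ps Tm (F.image supp) hcover
  have h2 : ∑ x ∈ Ps, (2 * s) ^ (Tm x).card ≤ ∑ x ∈ I, (2 * s) ^ x.1 :=
    calc ∑ x ∈ Ps, (2 * s) ^ (Tm x).card = ∑ x ∈ Ps, (2 * s) ^ x.1 :=
          Finset.sum_congr rfl fun x hx => by rw [hcard x hx]
      _ ≤ ∑ x ∈ I, (2 * s) ^ x.1 :=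
          Finset.sum_le_sum_of_subset_of_nonneg (Finset.filter_subset _ _) fun _ _ _ => pow_nonneg (by positivity) _
  have h3 : ∑ x ∈ I, (2 * s) ^ x.1 =
      ∑ n ∈ Finset.Ico n₀ (Mx + 1), (Fintype.card B : ℝ) * ((saws d n).card : ℝ) * (2 * s) ^ n := by
    rw [hI, Finset.sum_sigma]
    refine Finset.sum_congr rfl fun n _ => ?_
    show ∑ y ∈ (univ : Finset B) ×ˢ saws d n, (2 * s) ^ n = _
    rw [Finset.sum_const, Finset.card_product, Finset.card_univ, nsmul_eq_mul]
    push_cast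
    ring
  have h4 : ∀ n ∈ Finset.Ico n₀ (Mx + 1),
      (Fintype.card B : ℝ) * ((saws d n).card : ℝ) * (2 * s) ^ n ≤ (Fintype.card B : ℝ) * C * r' ^ n := by
    intro n _
    have hc : ((saws d n).card : ℝ) ≤ C * ν ^ n := by
      rw [card_saws]
      exact hC n
    have hk : (0 : ℝ) ≤ (Fintype.card B : ℝ) := by positivity
    calc (Fintype.card B : ℝ) * ((saws d n).card : ℝ) * (2 * s) ^ n
        ≤ (Fintype.card B : ℝ) * (C * ν ^ n) * (2 * s) ^ n :=
          mul_le_mul_of_nonneg_right (mul_le_mul_of_nonneg_left hc hk) (pow_nonneg (by positivity) _)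
      _ = (Fintype.card B : ℝ) * C * r' ^ n := by
          rw [hr, mul_pow, mul_pow]
          ring
  have hgeom := geom_tail_le hr0' hr1 n₀ (Mx + 1)
  calc ∑ S ∈ F.image supp, indepWeight r S
      ≤ ∑ x ∈ Ps, (2 * s) ^ (Tm x).card := h1
    _ ≤ ∑ x ∈ I, (2 * s) ^ x.1 := h2
    _ = ∑ n ∈ Finset.Ico n₀ (Mx + 1), (Fintype.card B : ℝ) * ((saws d n).card : ℝ) * (2 * s) ^ n := h3
    _ ≤ ∑ n ∈ Finset.Ico n₀ (Mx + 1), (Fintype.card B : ℝ) * C * r' ^ n := Finset.sum_le_sum h4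
    _ = (Fintype.card B : ℝ) * C * ∑ n ∈ Finset.Ico n₀ (Mx + 1), r' ^ n := by rw [Finset.mul_sum]
    _ ≤ (Fintype.card B : ℝ) * C * (r' ^ n₀ / (1 - r')) := mul_le_mul_of_nonneg_left hgeom (by positivity)
    _ = (Fintype.card B : ℝ) * C * r' ^ n₀ / (1 - r') := by ring

open Classical in
/-- **The i.i.d. case** of the counting bound (rate `0 ≤ p ≤ 1/2`, `r = 2ν√(p(1-p)) < 1`):
`Σ_{E : odd-crossing residual} p^{|E|}(1-p)^{|Λ|-|E|} ≤ |B|·C·r^{n₀}/(1-r)`. [cite: DennisEtAl2002, §5.2 eqs. (27)–(28), §5.3 eqs. (29), (fail)] -/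
theorem sum_bernoulliWeight_oddResidual_le [Fintype X] [Fintype Λ] [DecidableEq Λ] [Fintype B] {n₀ : ℕ}
    (hgap : Δ.HeightGap n₀) {C ν : ℝ} (hν : 0 < ν) (hC : ∀ n : ℕ, (SAW.Zd.count d n : ℝ) ≤ C * ν ^ n)
    {D : Decoder (X → ZMod 2) (Λ → ZMod 2)}
    (hD : D.IsMinWeight (fun e => M *ᵥ e) {x | M *ᵥ x = 0} hammingNorm)
    {p : ℝ} (hp0 : 0 ≤ p) (hp : p ≤ 1 / 2) (hr1 : 2 * ν * Real.sqrt (p * (1 - p)) < 1) :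
    ∑ E ∈ univ.filter (fun E : Λ → ZMod 2 => ∑ ℓ, (D (M *ᵥ E) + E) ℓ * Δ.bot ℓ = 1), bernoulliWeight p (supp E) ≤
      (Fintype.card B : ℝ) * C * (2 * ν * Real.sqrt (p * (1 - p))) ^ n₀ / (1 - 2 * ν * Real.sqrt (p * (1 - p))) := by
  simp only [bernoulliWeight_eq_indepWeight]
  exact Δ.sum_indepWeight_oddResidual_le hgap hν hC hD (fun _ => hp0) (fun _ => le_rfl) hp hr1

end CheckDrawing

end Literature.InformationTheory.QuantumCodes
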